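import Literature.Geometry.Kaehler.RiemannSurfaceAbelJacobiFiniteKernel
import Literature.Geometry.Kaehler.RiemannSurfaceCharacterGroup
import Literature.Geometry.Kaehler.RiemannSurfaceJacobianDivisionPoints
import HarnessLib

/-!
# Torsion of `Pic(M)` of order coprime to the kernel of `A`: `Pic(M)[m] ≅ Jac(M)[m]`, `#Pic(M)[m] = m^{2g}`,
# and the torsion case of Farkas–Kra III.9.11 (every character of exponent `m` is a divisor character)

Layer `Literature/Geometry/Kaehler`, sequel of `RiemannSurfaceAbelJacobiFiniteKernel` (the kernel of
`A : Pic⁰(M) → Jac(M)` is a finite subgroup, `finite_ker_abelJacobi_inf_ker_degree`),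
`RiemannSurfaceCharacterGroup` (`#Pic(M)[m] ≤ m^{2g}`, `#{χ : χ^m = 1} = m^{2g}`, `[D] ↦ χ_D` injective) and
`RiemannSurfaceJacobianDivisionPoints` (`#Jac(M)[m] = m^{rank Λ}`; `rank Λ = 2g` is `finrank_int_periods`).

WHAT IS PRINTED, AND WHAT IS PROVED HERE.  Abel's theorem (Farkas–Kra III.6.3; Miranda VIII Theorem 2.2 and
§4 «Abel's Theorem states that the kernel of `A₀` is exactly the subgroup `PDiv(X)`», p0264) makes
`A : Pic⁰(M) → Jac(M)` an isomorphism, so `Pic(M)[m] ≅ Jac(M)[m] ≅ (ℤ/mℤ)^{2g}` for every `m ≥ 1`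
(Lange, *Abelian Varieties over the Complex Numbers*, Proposition 1.1.14: `X[n] ≅ (ℤ/nℤ)^{2g}`), and
Farkas–Kra III.9.11 («every character of `π₁(M)` is the character of a unique (up to constants)
multiplicative function») then says `[D] ↦ χ_D` is onto.  The tree has Abel's theorem only UP TO TORSION
(`ker(A|Pic⁰)` finite, of some order `k ≥ 1`).  For `m ≥ 1` COPRIME TO `k` everything already follows, by
Bézout: **`A : Pic(M)[m] → Jac(M)[m]` is a bijection** (`PicardGroup.bijective_abelJacobiTorsion_of_coprime`,
`PicardGroup.abelJacobiTorsionEquiv`), **`#Pic(M)[m] = m^{2g}`** (`natCard_nsmul_ker_picardGroup_eq_of_coprime`;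
base-point free: `exists_forall_coprime_natCard_nsmul_ker_picardGroup_eq` — so `#Pic(M)[p] = p^{2g}` for all
but finitely many primes `p`), and **every character `χ` with `χ^m = 1` is `χ_D` for a unique `m`-torsion
class `[D]`** (`bijective_picZeroCharacter_torsion_of_coprime`,
`existsUnique_divisorCharacter_eq_of_pow_eq_one_of_coprime`) — the torsion case of III.9.11, by counting
(`m^{2g}` on both sides) and the injectivity III.9.10.  NOT here: the same for `m` not coprime to `k`
(equivalent to Abel's theorem proper).  Everything proved; no named facts, no instances.

## References

* [FarkasKra1992] H. M. Farkas, I. Kra, *Riemann Surfaces*, GTM 71, 2nd ed., Springer (1992), III.6.3,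
  III.9.10, III.9.11.
* [Miranda1995] R. Miranda, *Algebraic Curves and Riemann Surfaces*, GSM 5, AMS (1995), Chapter VIII
  Theorem 2.2, §4.
* [Lange2023AbelianVarietiesComplex] H. Lange, *Abelian Varieties over the Complex Numbers*, Springer
  (2023), §1.1.2 Proposition 1.1.14.
-/

noncomputable section

open scoped Manifold ContDiff Topology
open Set Function

namespace Literature.Geometry.Kaehler

namespace RiemannSurface

open Literature.Topology.CoveringSpaces

universe u

variable {M : Type u} [TopologicalSpace M] [ChartedSpace ℂ M] [ConnectedSpace M]
  [IsManifold 𝓘(ℂ, ℂ) ω M] [CompactSpace M] [T2Space M] (x₀ : M)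

/-! ### §1 `A : Pic(M)[m] → Jac(M)[m]`, a bijection for `m` coprime to `#ker(A|Pic⁰)` -/

/-- `A : Pic(M)[m] → Jac(M)[m]` (restriction of the Abel–Jacobi map to the `m`-torsion subgroups).
[cite: Miranda1995, Chapter VIII §4] -/
def PicardGroup.abelJacobiTorsion (m : ℕ) :
    ↥(nsmulAddMonoidHom m : PicardGroup M →+ PicardGroup M).ker →+
      ↥(nsmulAddMonoidHom m : Jacobian x₀ →+ Jacobian x₀).ker :=
  ((PicardGroup.abelJacobi x₀).comp (nsmulAddMonoidHom m : PicardGroup M →+ PicardGroup M).ker.subtype).codRestrict _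
    fun c ↦ by
      rw [AddMonoidHom.mem_ker, nsmulAddMonoidHom_apply, AddMonoidHom.coe_comp, comp_apply, ← map_nsmul,
        AddSubgroup.coe_subtype, ← nsmulAddMonoidHom_apply, (AddMonoidHom.mem_ker).1 c.2, map_zero]

/-- Unfolding `PicardGroup.abelJacobiTorsion`. [cite: Miranda1995, Chapter VIII §4] -/
@[simp]
theorem PicardGroup.coe_abelJacobiTorsion_apply (m : ℕ)
    (c : ↥(nsmulAddMonoidHom m : PicardGroup M →+ PicardGroup M).ker) :
    ((PicardGroup.abelJacobiTorsion x₀ m c : ↥(nsmulAddMonoidHom m : Jacobian x₀ →+ Jacobian x₀).ker) :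
      Jacobian x₀) = PicardGroup.abelJacobi x₀ c := rfl

/-- The finite kernel `ker A ⊓ ker deg` is killed by its order. [cite: FarkasKra1992, III.6.3 (Theorem (Abel))] -/
theorem PicardGroup.natCard_ker_nsmul_eq_zero {c : PicardGroup M}
    (hc : c ∈ (PicardGroup.abelJacobi x₀).ker ⊓ (PicardGroup.degree M).ker) :
    Nat.card ↥((PicardGroup.abelJacobi x₀).ker ⊓ (PicardGroup.degree M).ker) • c = 0 := by
  haveI := finite_ker_abelJacobi_inf_ker_degree x₀
  have h1 : Nat.card ↥((PicardGroup.abelJacobi x₀).ker ⊓ (PicardGroup.degree M).ker) •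
      (⟨c, hc⟩ : ↥((PicardGroup.abelJacobi x₀).ker ⊓ (PicardGroup.degree M).ker)) = 0 :=
    addOrderOf_dvd_iff_nsmul_eq_zero.1 (addOrderOf_dvd_natCard _)
  have h2 := congrArg Subtype.val h1
  rwa [AddSubmonoidClass.coe_nsmul] at h2

/-- **For `m ≥ 1` coprime to the order of the (finite) kernel of `A : Pic⁰(M) → Jac(M)`, the Abel–Jacobi map
is a BIJECTION `Pic(M)[m] ≅ Jac(M)[m]`** (injective: a degree-zero class in the kernel killed by `m` and by
`#ker` is `0` by Bézout; surjective: `Pic⁰(M) ↠ Jac(M)` by Jacobi inversion, and for a degree-zero preimage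
`x` of `j ∈ Jac(M)[m]` one has `m·x ∈ ker`, so `v·#ker·x` is an `m`-torsion preimage of `j` when
`u m + v·#ker = 1`).  With Abel's theorem as printed (`ker = 0`) this holds for every `m ≥ 1`; that is not
claimed. [cite: Miranda1995, Chapter VIII Theorem 2.2, §4 («`Pic⁰(X) ≅ Jac(X)`»)] [cite: Lange2023AbelianVarietiesComplex, §1.1.2 Proposition 1.1.14] -/
theorem PicardGroup.bijective_abelJacobiTorsion_of_coprime {m : ℕ} [NeZero m]
    (hm : m.Coprime (Nat.card ↥((PicardGroup.abelJacobi x₀).ker ⊓ (PicardGroup.degree M).ker))) :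
    Bijective (PicardGroup.abelJacobiTorsion x₀ m) := by
  set H := (PicardGroup.abelJacobi x₀).ker ⊓ (PicardGroup.degree M).ker with hH
  set k := Nat.card ↥H with hk
  -- Bézout: `1 = u m + v k`
  obtain ⟨u, v, huv⟩ : ∃ u v : ℤ, (1 : ℤ) = m * u + k * v := by
    refine ⟨Nat.gcdA m k, Nat.gcdB m k, ?_⟩
    rw [← Nat.gcd_eq_gcd_ab m k, Nat.Coprime.gcd_eq_one hm, Nat.cast_one]
  have key : ∀ c : PicardGroup M, m • c = 0 → k • c = 0 → c = 0 := fun c h1 h2 ↦ by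
    have h3 : (1 : ℤ) • c = 0 := by
      rw [huv, add_zsmul, mul_zsmul, mul_zsmul, natCast_zsmul, natCast_zsmul, smul_comm m u c, h1, smul_zero,
        zero_add, smul_comm k v c, h2, smul_zero]
    rwa [one_zsmul] at h3
  constructor
  · rintro ⟨a, ha⟩ ⟨b, hb⟩ h
    have hab : PicardGroup.abelJacobi x₀ a = PicardGroup.abelJacobi x₀ b := by
      have := congrArg (fun z : ↥(nsmulAddMonoidHom m : Jacobian x₀ →+ Jacobian x₀).ker ↦ (z : Jacobian x₀)) h
      simpa using this
    have ha' : m • a = 0 := (AddMonoidHom.mem_ker).1 ha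
    have hb' : m • b = 0 := (AddMonoidHom.mem_ker).1 hb
    have hmem : a - b ∈ H := by
      refine AddSubgroup.mem_inf.2 ⟨(AddMonoidHom.mem_ker).2 (by rw [map_sub, hab, sub_self]),
        (AddMonoidHom.mem_ker).2 ?_⟩
      rw [map_sub, PicardGroup.degree_eq_zero_of_nsmul_eq_zero ha', PicardGroup.degree_eq_zero_of_nsmul_eq_zero hb',
        sub_self]
    have h0 : a - b = 0 :=
      key (a - b) (by rw [nsmul_sub, ha', hb', sub_self]) (PicardGroup.natCard_ker_nsmul_eq_zero x₀ hmem)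
    exact Subtype.ext (sub_eq_zero.1 h0)
  · rintro ⟨j, hj⟩
    have hj' : m • j = 0 := (AddMonoidHom.mem_ker).1 hj
    obtain ⟨x, hx0, hxj⟩ := PicardGroup.exists_mem_ker_degree_abelJacobi_eq x₀ j
    have hmx : m • x ∈ H := by
      refine AddSubgroup.mem_inf.2 ⟨(AddMonoidHom.mem_ker).2 (by rw [map_nsmul, hxj, hj']),
        (AddMonoidHom.mem_ker).2 (by rw [map_nsmul, (AddMonoidHom.mem_ker).1 hx0, smul_zero])⟩
    have hkm : k • (m • x) = 0 := PicardGroup.natCard_ker_nsmul_eq_zero x₀ hmx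
    -- the `m`-torsion preimage `y = (v k) • x`
    refine ⟨⟨(v * k) • x, (AddMonoidHom.mem_ker).2 ?_⟩, Subtype.ext ?_⟩
    · rw [nsmulAddMonoidHom_apply, ← natCast_zsmul, ← mul_zsmul, show ((m : ℕ) : ℤ) * (v * k) = v * (k * m) by ring,
        mul_zsmul, mul_zsmul, natCast_zsmul, natCast_zsmul, hkm, smul_zero]
    · show PicardGroup.abelJacobi x₀ ((v * k) • x) = j
      rw [map_zsmul, hxj]
      -- `(v k) • j = (1 - u m) • j = j`
      have h1 : (v * k : ℤ) = 1 - m * u := by rw [huv]; ring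
      rw [h1, sub_zsmul, one_zsmul, mul_comm, mul_zsmul, natCast_zsmul, hj', smul_zero]
      simp

/-- The Abel–Jacobi isomorphism `Pic(M)[m] ≃+ Jac(M)[m]` for `m ≥ 1` coprime to `#ker(A|Pic⁰)`.
[cite: Miranda1995, Chapter VIII Theorem 2.2, §4] -/
def PicardGroup.abelJacobiTorsionEquiv {m : ℕ} [NeZero m]
    (hm : m.Coprime (Nat.card ↥((PicardGroup.abelJacobi x₀).ker ⊓ (PicardGroup.degree M).ker))) :
    ↥(nsmulAddMonoidHom m : PicardGroup M →+ PicardGroup M).ker ≃+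
      ↥(nsmulAddMonoidHom m : Jacobian x₀ →+ Jacobian x₀).ker :=
  AddEquiv.ofBijective _ (PicardGroup.bijective_abelJacobiTorsion_of_coprime x₀ hm)

/-- Unfolding `PicardGroup.abelJacobiTorsionEquiv`. [cite: Miranda1995, Chapter VIII §4] -/
@[simp]
theorem PicardGroup.coe_abelJacobiTorsionEquiv_apply {m : ℕ} [NeZero m]
    (hm : m.Coprime (Nat.card ↥((PicardGroup.abelJacobi x₀).ker ⊓ (PicardGroup.degree M).ker)))
    (c : ↥(nsmulAddMonoidHom m : PicardGroup M →+ PicardGroup M).ker) :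
    ((PicardGroup.abelJacobiTorsionEquiv x₀ hm c : ↥(nsmulAddMonoidHom m : Jacobian x₀ →+ Jacobian x₀).ker) :
      Jacobian x₀) = PicardGroup.abelJacobi x₀ c := rfl

/-- **`#Pic(M)[m] = m^{2g}` for every `m ≥ 1` coprime to the order of the kernel of `A` on `Pic⁰(M)`**
(`Pic(M)[m] ≅ Jac(M)[m]` and `#Jac(M)[m] = m^{rank Λ} = m^{2g}`, the tree's `natCard_divisionPoints` and
`finrank_int_periods`).  The inequality `≤` holds for every `m` (`RiemannSurfaceCharacterGroup`).
[cite: Lange2023AbelianVarietiesComplex, §1.1.2 Proposition 1.1.14] [cite: Miranda1995, Chapter VIII §4] -/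
theorem natCard_nsmul_ker_picardGroup_eq_of_coprime {m : ℕ} [NeZero m]
    (hm : m.Coprime (Nat.card ↥((PicardGroup.abelJacobi x₀).ker ⊓ (PicardGroup.degree M).ker))) :
    Nat.card ↥(nsmulAddMonoidHom m : PicardGroup M →+ PicardGroup M).ker = m ^ (2 * arithGenus M) := by
  rw [Nat.card_congr (Equiv.ofBijective _ (PicardGroup.bijective_abelJacobiTorsion_of_coprime x₀ hm)),
    natCard_divisionPoints x₀ (NeZero.ne m), finrank_int_periods]

/-- Base-point-free packaging: **there is `k ≥ 1` such that `#Pic(M)[m] = m^{2g}` for every `m ≥ 1` coprime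
to `k`** — in particular for all but finitely many primes `p`, `#Pic(M)[p] = p^{2g}`.
[cite: Lange2023AbelianVarietiesComplex, §1.1.2 Proposition 1.1.14] [cite: Miranda1995, Chapter VIII §4] -/
theorem exists_forall_coprime_natCard_nsmul_ker_picardGroup_eq :
    ∃ k : ℕ, 0 < k ∧ ∀ m : ℕ, m ≠ 0 → m.Coprime k →
      Nat.card ↥(nsmulAddMonoidHom m : PicardGroup M →+ PicardGroup M).ker = m ^ (2 * arithGenus M) := by
  obtain ⟨x₀⟩ : Nonempty M := inferInstance
  haveI := finite_ker_abelJacobi_inf_ker_degree x₀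
  refine ⟨Nat.card ↥((PicardGroup.abelJacobi x₀).ker ⊓ (PicardGroup.degree M).ker), Nat.card_pos,
    fun m hm0 hm ↦ ?_⟩
  haveI : NeZero m := ⟨hm0⟩
  exact natCard_nsmul_ker_picardGroup_eq_of_coprime x₀ hm

/-! ### §2 Every character of exponent `m` (coprime to `#ker`) is a divisor character -/

/-- **For `m ≥ 1` coprime to `#ker(A|Pic⁰)`, `[D] ↦ χ_D` is a BIJECTION from `Pic(M)[m]` onto the
characters `χ` of `π₁(M, x₀)` with `χ^m = 1`** (injective by III.9.10; both sides have `m^{2g}` elements)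
— a torsion case of III.9.11 «every character is the character of a multiplicative function».
[cite: FarkasKra1992, III.9.11, III.9.10, III.9.3] -/
theorem bijective_picZeroCharacter_torsion_of_coprime {m : ℕ} [NeZero m]
    (hm : m.Coprime (Nat.card ↥((PicardGroup.abelJacobi x₀).ker ⊓ (PicardGroup.degree M).ker))) :
    Bijective (fun c : ↥(nsmulAddMonoidHom m : PicardGroup M →+ PicardGroup M).ker ↦
      (⟨Additive.toMul (picZeroCharacter x₀ ⟨(c : PicardGroup M), (PicardGroup.degree M).mem_ker.2
          (PicardGroup.degree_eq_zero_of_nsmul_eq_zero ((AddMonoidHom.mem_ker).1 c.2))⟩),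
        pow_picZeroCharacter_eq_one ((AddMonoidHom.mem_ker).1 c.2)⟩ :
        {χ : FundamentalGroup M x₀ →* ℂˣ // χ ^ m = 1})) := by
  haveI := finite_characters_pow_eq_one x₀ m
  refine Function.Injective.bijective_of_nat_card_le (fun c c' h ↦ ?_) ?_
  · have h1 := Additive.toMul.injective (congrArg Subtype.val h)
    have h2 : (c : PicardGroup M) = c' :=
      congrArg (Subtype.val : ↥(PicardGroup.degree M).ker → PicardGroup M) (picZeroCharacter_injective h1)
    exact Subtype.ext h2
  · rw [natCard_characters_pow_eq_one_eq x₀ m, natCard_nsmul_ker_picardGroup_eq_of_coprime x₀ hm]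

/-- Hence **every character `χ` of `π₁(M, x₀)` with `χ^m = 1`, `m ≥ 1` coprime to `#ker(A|Pic⁰)`, is the
normalized character `χ_D` of a unique `m`-torsion divisor class**. [cite: FarkasKra1992, III.9.11, III.9.10] -/
theorem existsUnique_divisorCharacter_eq_of_pow_eq_one_of_coprime {m : ℕ} [NeZero m]
    (hm : m.Coprime (Nat.card ↥((PicardGroup.abelJacobi x₀).ker ⊓ (PicardGroup.degree M).ker)))
    (χ : FundamentalGroup M x₀ →* ℂˣ) (hχ : χ ^ m = 1) :
    ∃! c : ↥(nsmulAddMonoidHom m : PicardGroup M →+ PicardGroup M).ker,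
      Additive.toMul (picZeroCharacter x₀ ⟨(c : PicardGroup M), (PicardGroup.degree M).mem_ker.2
        (PicardGroup.degree_eq_zero_of_nsmul_eq_zero ((AddMonoidHom.mem_ker).1 c.2))⟩) = χ := by
  obtain ⟨c, hc⟩ := (bijective_picZeroCharacter_torsion_of_coprime x₀ hm).2 ⟨χ, hχ⟩
  refine ⟨c, by simpa using congrArg Subtype.val hc, fun c' hc' ↦ ?_⟩
  apply (bijective_picZeroCharacter_torsion_of_coprime x₀ hm).1
  rw [hc]
  exact Subtype.ext hc'

end RiemannSurface

end Literature.Geometry.Kaehler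

end
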